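import Summits.BirchSwinnertonDyer.BirchSwinnertonDyer.Theorems.ByReductionTypeAtTwoFineSelmerConjAAtTwoAdditivePotGoodAscentStampsA
import HarnessLib

/-!
# C4″ `AdditivePotMultOverKAtTwo` (item stmt-BirchSwinnertonDyer-22618), the (I1M′) input of the upper half on the `Δ < 0` rows:
# KERNEL STAMPS, part P — Iwasawa's `μ₂ = 0` (ZERO hypotheses) for the `2`-torsion cubic fields `d = -516` and UNCONDITIONAL
# statement (A) at `2` for the C4″ census curves 266256cs1, 355008cc1

Cell `bsd-2adic`, rung K4, seat `bsd-2adic-k4-w3` GEN 11 (explicit unit of director-bsd g16 (309)(7); `--supports stmt-BirchSwinnertonDyer-22618`).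
HONEST FRAMING (D-0036/D-0054/D-0152): THEOREMS ONLY (no definition, no named fact, no `sorry`). FIELD PART (unconditional kernel arithmetic about an
explicit cubic field `ℚ(θ)`; generator = eng-2's polredabs cubic when its index `[𝓞 : ℤ[θ]]` is odd, else an odd-index second generator):
`irreducible_cubic_<d>`, `odd_classNumber_of_root_<d>` (norm certificate below the Minkowski bound; k4-w1's `odd_classNumber_of_cubeCertificate`),
**`classicalMu_two_cubicField_<d>`** = `μ = 0` (growth form) along EVERY cyclotomic `ℤ₂`-extension of `ℚ(θ)` from `e₀ = 0` (odd `h`), `e₁ = 0` (k4-w1's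
Chevalley door at `2`, `layerOneBit_of_chevalleyCert`: a unit with `2`-adic image `≡ ±3 (mod 8)` is not a norm from `ℚ(θ, √2)`; ≤ 2 primes above `2`),
`n₀ = 0` (odd cubic discriminant `…_of_odd_cubic_discr`, or `2 = 𝔭𝔮²` with an even-index certificate `…_of_evenIndexCertificate`) and Fukuda 1994 Thm. 1 (1)
(`_holds`). These fields have TWO primes above `2` (the `2`-division cubic of a potentially multiplicative curve has a `ℚ₂`-root). ROW PART:
`conjA_two_<L>'` = Coates–Sujatha's statement (A) at `p = 2` for the census cubic model of the Cremona class (a-invariants of addL2x GEN 13's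
`nst_census-j313647.tsv`), PROVED OUTRIGHT: field identification `ℚ(β) = ℚ(θ)` + cruxlead-19573-w2's door
`TotallyComplexMu.conjA_two_cubicModel_of_classicalMu_of_discr_neg` (kernel Lim 3.5@2 + `ℓ = 2` ascent). Certificates (norm witnesses, fundamental units by a
relation sieve, Hensel data, even-index elements) found by the seat's exact-arithmetic tools (`work/tools/`) and CHECKED HERE by the kernel; eng-2's
census CERT-ADD-POTMULT-FUKUDA269-E2 agrees (`μ₂ = λ₂ = 0`, bnfcertify). Statement (A) is NOT BSD: BSD₂ for these curves is not proved; C4″ / (I1M′) stay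
research-open; nothing booked; no row of 22618 changes tier (pen RC-490 (4)). Pattern/toolkit: k4-w1 GEN 5–8 (`…MuTwoKernelRows{A,B}`, `…AscentStampsA`).

References: [CoatesSujatha2005] Conj. A, Thm. 3.4; [Iwasawa1973MuInvariants] Thm. 2/3; [Fukuda1994] Thm. 1 (1); [Lang1990] Ch. 13 §4 Lemma 4.1;
[Washington1997] §13.1; [Marcus1977] Ch. 5 Thm. 35–37; [Cohen1993] §6.3; [Lim2017FineSelmer] §3; cell files `eng2/fukuda269/{TABLE,LAYERS}-…-E2-v1.tsv`.
-/

set_option autoImplicit false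
-- sibling precedent (`…MuTwoKernelRowsA.lean`): the directory name repeats the summit name
set_option linter.dupNamespace false

noncomputable section
open scoped Classical IntermediateField NumberField Real nonZeroDivisors
namespace Summit.BirchSwinnertonDyer.BirchSwinnertonDyer.Theorems.AddKatoTwo
open WeierstrassCurve Field Polynomial IsDedekindDomain NumberField Matrix Literature.NumberTheory.EllipticCurves
  Literature.NumberTheory.GaloisRepresentations
  Literature.NumberTheory.IwasawaTheory
  Summit.BirchSwinnertonDyer.BirchSwinnertonDyer.Theorems.SteinbergFibreAtTwo
  Summit.BirchSwinnertonDyer.BirchSwinnertonDyer.Theorems.AlignedTransportAtTwoTorsionPointField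
  Summit.BirchSwinnertonDyer.BirchSwinnertonDyer.Theses.ByReductionTypeAtTwo

/-! ## The cubic field of discriminant `-516` — odd-index generator `X³ + (-8)X² + (5)X + (-4)` (`[𝓞 : ℤ[θ]] = 3`; eng-2's polredabs cubic `X³ + (-1)X² + (1)X + (-9)` has EVEN
index `2`, unusable at `2`; `θ = (5/2) + (1)·θ₀ + (1/2)·θ₀²`); C4″ rows 266256cs1, 355008cc1 -/

/-- `X³ + (-8)X² + (5)X + (-4)` is irreducible over `ℚ` (no root mod `5`). -/
theorem irreducible_cubic_d516n : Irreducible (Cubic.toPoly ⟨1, ((-8 : ℤ) : ℚ), ((5 : ℤ) : ℚ), ((-4 : ℤ) : ℚ)⟩) :=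
  haveI : Fact (Nat.Prime 5) := ⟨by norm_num⟩
  irreducible_cubic_of_no_root_zmod 5 (by decide)

/-- `X³ + (-1)X² + (1)X + (-9)` (the polredabs cubic of the same field) is irreducible over `ℚ` (no root mod `5`). -/
theorem irreducible_cubic_d516n_aux : Irreducible (Cubic.toPoly ⟨1, ((-1 : ℤ) : ℚ), ((1 : ℤ) : ℚ), ((-9 : ℤ) : ℚ)⟩) :=
  haveI : Fact (Nat.Prime 5) := ⟨by norm_num⟩
  irreducible_cubic_of_no_root_zmod 5 (by decide)

section Certd516n

variable (K : Type) [Field K] [NumberField K]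

/-- **`h` is ODD for every cubic number field whose integers contain a root `θ` of `X³ + (-8)X² + (5)X + (-4)`** (`|disc| = 4644 = 3²·516`,
`|d_K| ≤ 516` by the index-`3` element `θ₀`, `M_K < 7`): a norm certificate — for every prime `ℓ < 7` and every root `a` of the cubic mod `ℓ` a generator
`(x + yθ + zθ²)/m ∈ 𝓞 K` of the ideal `I ∋ ℓ, θ − a` of norm `ℓ` (4 witnesses; 0 with `m = 3` outside `ℤ[θ]`; the prime(s) dividing the index `3` through the
second generator `θ₀` of `𝓞 K` (`exists_intElem_of_scaled_cubic`), 2 witnesses). Found by the seat's relation sieve (Hermite normal form over the `S`-unit lattice) and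
CHECKED HERE by the kernel (`pow_three_eq_span_of_cert`, `Or.inl`). eng-2's PARI value (bnfcertify): `h = 1`. KERNEL. [cite: Marcus1977, Ch. 5 Thm. 35–37 and Cor. 2] [cite: Cohen1993, §6.3] -/
theorem odd_classNumber_of_root_d516n (h3 : Module.finrank ℚ K = 3) (b : 𝓞 K)
    (hb : b ^ 3 + (-8 : ℤ) * b ^ 2 + (5 : ℤ) * b + (-4 : ℤ) = 0) : Odd (NumberField.classNumber K) := by
  have hirr := irreducible_cubic_d516n
  -- second generator `b2 = ((-5) + (9)θ + (-1)θ²)/3 = θ₀`, a root of `X³ + (-1)X² + (1)X + (-9)` (index `2`, prime to `3`)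
  obtain ⟨b2, hb2m, hb2⟩ := exists_intElem_of_scaled_cubic K b (-5) (9) (-1) (m := 3) (by norm_num) (-1) (1) (-9)
    (by push_cast; linear_combination (((122 : ℤ) : 𝓞 K) + ((-104 : ℤ) : 𝓞 K) * b + ((19 : ℤ) : 𝓞 K) * b ^ 2 + ((-1 : ℤ) : 𝓞 K) * b ^ 3 + ((0 : ℤ) : 𝓞 K) * b ^ 4) * hb)
  have hd : |NumberField.discr K| ≤ (516 : ℕ) :=
    abs_discr_le_of_sq_mul_le K (k := 3) (by norm_num)
      (sq_mul_abs_discr_le_abs_cubic_discr K h3 b hirr hb (by norm_num) (-5) (9) (-1) ⟨b2, hb2m⟩ (by norm_num))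
      (by simp only [Cubic.discr]; norm_num)
  have hirr2 := irreducible_cubic_d516n_aux
  refine odd_classNumber_of_cubeCertificate K h3 (B := 7)
    (minkowskiBound_lt_of_sqrt_le K h3 hd (s := 22.72)
      ((Real.sqrt_le_sqrt (by norm_num : ((516 : ℕ) : ℝ) ≤ (22.72 : ℝ) ^ 2)).trans (Real.sqrt_sq (by norm_num)).le)
      (by norm_num)) ?_
  intro ℓ hℓB hℓ J hJ
  interval_cases ℓ <;> norm_num at hℓ
  · -- `ℓ = 2`: roots [0, 1]
    refine pow_three_eq_span_of_cert K h3 b hirr hb (by norm_num) (fun a ha hdvd => ?_) hJ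
    interval_cases a <;> norm_num at hdvd
    · exact Or.inl ⟨(114), (-45), (4), 1, by norm_num, by norm_num, ⟨_, by rw [Nat.cast_one, one_mul]⟩, by norm_num⟩
    · exact Or.inl ⟨(1), (-1), (2), 1, by norm_num, by norm_num, ⟨_, by rw [Nat.cast_one, one_mul]⟩, by norm_num⟩
  · -- `ℓ = 3` divides the index of `ℤ[θ]`: second generator `b2`, roots [0, 2]
    refine pow_three_eq_span_of_cert K h3 b2 hirr2 hb2 (by norm_num) (fun a ha hdvd => ?_) hJ
    interval_cases a <;> norm_num at hdvd
    · exact Or.inl ⟨(-3), (-1), (1), 1, by norm_num, by norm_num, ⟨_, by rw [Nat.cast_one, one_mul]⟩, by norm_num⟩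
    · exact Or.inl ⟨(2), (-1), (0), 1, by norm_num, by norm_num, ⟨_, by rw [Nat.cast_one, one_mul]⟩, by norm_num⟩
  · -- `ℓ = 5`: roots []
    refine pow_three_eq_span_of_cert K h3 b hirr hb (by norm_num) (fun a ha hdvd => ?_) hJ
    interval_cases a <;> norm_num at hdvd

end Certd516n

/-- **Iwasawa's `μ₂ = 0` for the cubic field of discriminant `-516`** (`ℚ(θ)`, `θ³ + (-8)θ² + (5)θ + (-4) = 0`, index `3`; TWO primes above `2`,
`2 = 𝔭𝔮²`; `h` odd), KERNEL — every cyclotomic `ℤ₂`-extension of `ℚ(θ)` has `μ = 0` (growth form; indeed `e_n = 0` for all `n`).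
Chevalley's door at `2` (k4-w1 `layerOneBit_of_chevalleyCert`): the fundamental unit `ε = ((-19) + (21)θ + (-35)θ²)/3` (regulator ≈ 6.39;
`ε³ + (593)ε² + (41)ε + (1) = 0`) has `ε ≡ 3 (mod 8)` under `θ ↦ z₂ ≡ 4` (`8 ∣ g(4)`, `g'(4)` odd), so `(ε, 2)_𝔭 = −1`: a non-norm
from `ℚ(θ, √2)`, whence `e₁ = 0`; `≤ 2` primes above `2` by `4 ∤ g(2)`, `4 ∤ g(1)`; `e₀ = 0` by `odd_classNumber_of_root_d516n`; `n₀ = 0` by an even-index certificate in `ℤ[θ]` (`classicalMuVanishes_two_adjoin_of_evenIndexCertificate`); Fukuda 1994 Thm. 1 (1) (`_holds`).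
The (I1M′) input of GEN 9's door for the C4″ rows 266256cs1, 355008cc1. [cite: Fukuda1994, Thm. 1 (1), p. 264] [cite: Lang1990, Ch. 13 §4, Lemma 4.1]
[cite: Washington1997, §13.1] [cite: Greenberg2001IwasawaPastPresent, §4 (Iwasawa's μ-conjecture)] -/
theorem classicalMu_two_cubicField_d516n {θ : AlgebraicClosure ℚ} (hθ : aeval θ (Cubic.toPoly ⟨1, ((-8 : ℤ) : ℚ), ((5 : ℤ) : ℚ), ((-4 : ℤ) : ℚ)⟩) = 0) :
    haveI : FiniteDimensional ℚ (IntermediateField.adjoin ℚ {θ}) :=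
      IntermediateField.adjoin.finiteDimensional ((AlgebraicClosure.isAlgebraic ℚ).isAlgebraic θ).isIntegral
    haveI : NumberField (IntermediateField.adjoin ℚ {θ}) := NumberField.mk
    ∀ κL : ZpExtension (IntermediateField.adjoin ℚ {θ}) 2, κL.IsCyclotomic → ClassicalMuVanishes κL := by
  intro κL hκL
  have hθ' : θ ^ 3 + (-8 : AlgebraicClosure ℚ) * θ ^ 2 + (5 : AlgebraicClosure ℚ) * θ + (-4 : AlgebraicClosure ℚ) = 0 := by
    have := hθ
    simp only [Cubic.toPoly, map_one, one_mul, aeval_add, aeval_mul, aeval_C, aeval_X_pow, aeval_X,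
      eq_ratCast, Rat.cast_intCast] at this
    push_cast at this
    linear_combination this
  have he : aeval (algebraMap ℚ (AlgebraicClosure ℚ) (((-19 : ℤ) : ℚ) / ((3 : ℤ) : ℚ)) +
      algebraMap ℚ (AlgebraicClosure ℚ) (((21 : ℤ) : ℚ) / ((3 : ℤ) : ℚ)) * θ +
      algebraMap ℚ (AlgebraicClosure ℚ) (((-35 : ℤ) : ℚ) / ((3 : ℤ) : ℚ)) * θ ^ 2)
      (Cubic.toPoly ⟨1, ((593 : ℤ) : ℚ), ((41 : ℤ) : ℚ), ((1 : ℤ) : ℚ)⟩) = 0 := by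
    simp only [Cubic.toPoly, map_one, one_mul, aeval_add, aeval_mul, aeval_C, aeval_X_pow, aeval_X, eq_ratCast,
      Rat.cast_intCast, Rat.cast_div]
    push_cast
    field_simp
    linear_combination ((-157094 : AlgebraicClosure ℚ) + (150920 : AlgebraicClosure ℚ) * θ + (-265825 : AlgebraicClosure ℚ) * θ ^ 2 + (-42875 : AlgebraicClosure ℚ) * θ ^ 3) * hθ'
  have hh := not_two_dvd_card_classGroup_adjoin_of_forall_cubicField_odd irreducible_cubic_d516n (odd_classNumber_of_root_d516n) hθ
  have h1 := layerOneBit_of_chevalleyCert irreducible_cubic_d516n hθ hh ⟨1, by norm_num⟩ ⟨0, by norm_num⟩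
      (-19) (21) (-35) (3) (593) (41) (1) (by norm_num) he (4) (3) (by norm_num) (by norm_num) (by decide) (by decide)
  have hirr := irreducible_cubic_d516n
  haveI : FiniteDimensional ℚ (IntermediateField.adjoin ℚ {θ}) :=
    IntermediateField.adjoin.finiteDimensional ((AlgebraicClosure.isAlgebraic ℚ).isAlgebraic θ).isIntegral
  haveI : NumberField (IntermediateField.adjoin ℚ {θ}) := NumberField.mk
  obtain ⟨B, -, hB⟩ := exists_ringOfIntegers_cubic_root (p := -8) (q := 5) (r := -4) hθ
  have h3 := finrank_adjoin_eq_three_of_irreducible hirr hθ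
  refine classicalMuVanishes_two_adjoin_of_evenIndexCertificate (p := -8) (q := 5) (r := -4) hirr hθ
    (((0 : ℤ) : 𝓞 (IntermediateField.adjoin ℚ {θ})) + ((-2 : ℤ) : 𝓞 (IntermediateField.adjoin ℚ {θ})) * B + ((0 : ℤ) : 𝓞 (IntermediateField.adjoin ℚ {θ})) * B ^ 2) (((0 : ℤ) : 𝓞 (IntermediateField.adjoin ℚ {θ})) + ((-1 : ℤ) : 𝓞 (IntermediateField.adjoin ℚ {θ})) * B + ((-1 : ℤ) : 𝓞 (IntermediateField.adjoin ℚ {θ})) * B ^ 2) (((-20 : ℤ) : 𝓞 (IntermediateField.adjoin ℚ {θ})) + ((23 : ℤ) : 𝓞 (IntermediateField.adjoin ℚ {θ})) * B + ((-37 : ℤ) : 𝓞 (IntermediateField.adjoin ℚ {θ})) * B ^ 2) (((18700 : ℤ) : 𝓞 (IntermediateField.adjoin ℚ {θ})) + ((-20847 : ℤ) : 𝓞 (IntermediateField.adjoin ℚ {θ})) * B + ((34582 : ℤ) : 𝓞 (IntermediateField.adjoin ℚ {θ})) * B ^ 2) ?_ ?_ ?_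
    hh κL hκL (h1 κL hκL)
  · push_cast; linear_combination (((-20 : ℤ) : 𝓞 (IntermediateField.adjoin ℚ {θ})) + ((-2 : ℤ) : 𝓞 (IntermediateField.adjoin ℚ {θ})) * B + ((0 : ℤ) : 𝓞 (IntermediateField.adjoin ℚ {θ})) * B ^ 2) * hB
  · push_cast; linear_combination (((9250 : ℤ) : 𝓞 (IntermediateField.adjoin ℚ {θ})) + ((1369 : ℤ) : 𝓞 (IntermediateField.adjoin ℚ {θ})) * B + ((0 : ℤ) : 𝓞 (IntermediateField.adjoin ℚ {θ})) * B ^ 2) * hB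
  · have hz : (2 : 𝓞 (IntermediateField.adjoin ℚ {θ})) - (((18700 : ℤ) : 𝓞 (IntermediateField.adjoin ℚ {θ})) + ((-20847 : ℤ) : 𝓞 (IntermediateField.adjoin ℚ {θ})) * B + ((34582 : ℤ) : 𝓞 (IntermediateField.adjoin ℚ {θ})) * B ^ 2) ^ 3 =
        ((-57711967700651922 : ℤ) : 𝓞 (IntermediateField.adjoin ℚ {θ})) + (64338058812683889 : ℤ) * B + (-106726274008617018 : ℤ) * B ^ 2 := by
      push_cast; linear_combination (((-14426357124412981 : ℤ) : 𝓞 (IntermediateField.adjoin ℚ {θ})) + ((-1953899192917754 : ℤ) : 𝓞 (IntermediateField.adjoin ℚ {θ})) * B + ((-256063281129260 : ℤ) : 𝓞 (IntermediateField.adjoin ℚ {θ})) * B ^ 2 + ((-41357122985368 : ℤ) : 𝓞 (IntermediateField.adjoin ℚ {θ})) * B ^ 3 + ((0 : ℤ) : 𝓞 (IntermediateField.adjoin ℚ {θ})) * B ^ 4) * hB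
    rw [hz]
    exact not_eight_dvd_norm_coords _ h3 B hirr hB (-57711967700651922) (64338058812683889) (-106726274008617018) (N := -21643195266872298486)
      (by simp only [Matrix.one_fin_three, Matrix.det_fin_three, Matrix.add_apply, Matrix.smul_apply, sq, Matrix.mul_apply,
        Fin.sum_univ_three, Matrix.of_apply, Matrix.cons_val', Matrix.cons_val_zero, Matrix.cons_val_one, Matrix.cons_val_two,
        Matrix.head_cons, Matrix.tail_cons, Matrix.empty_val', Matrix.cons_val_fin_one, smul_eq_mul]; norm_num) (by norm_num)

/-! ### Row `266256cs1` (cubic field `d = -516`) -/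

/-- The census cubic model of the C4″ row `266256cs1` (`y² = x³ + (0)x² + (54621309)x + (-97907623038)`, addL2x GEN 13 `nst_census` a-invariants) is an elliptic curve. -/
theorem isElliptic_266256cs1' : (⟨0, ((0 : ℤ) : ℚ), 0, ((54621309 : ℤ) : ℚ), ((-97907623038 : ℤ) : ℚ)⟩ : WeierstrassCurve ℚ).IsElliptic :=
  isElliptic_cubicModel _ _ _ (by simp only [Cubic.discr]; norm_num)

/-- **UNCONDITIONAL (A)₂ for the C4″ census curve `266256cs1` — ZERO hypotheses, ZERO named facts** (additive potentially multiplicative at `2`,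
irreducible `E[2]`, `Δ < 0`; `2`-torsion cubic field `ℚ(θ)`, `θ³ + (-8)θ² + (5)θ + (-4) = 0`, `d = -4644`, `p q^2, F_q=Q2(sqrt-1)`, `h` odd). Coates–Sujatha's
statement (A) at `p = 2` for the cubic model `y² = x³ + (0)x² + (54621309)x + (-97907623038)`: for every cyclotomic `ℤ₂`-extension of `ℚ` the dual fine Selmer group
over `ℚ_∞` is finitely generated over `ℤ₂` (`∃ γ D` currency). KERNEL: `classicalMu_two_cubicField_d516n` above (μ₂(ℚ(θ)_cyc) = 0 for the field of `X³ + (-8)X² + (5)X + (-4)`) ⟹ cruxlead-19573-w2's `ℓ = 2` ascent to the totally complex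
`ℚ(E[2]) = ℚ(θ, √d)` and kernel Lim 3.5@2 (`TotallyComplexMu.conjA_two_cubicModel_of_classicalMu_of_discr_neg`); the root `β = x(T)` of the curve's cubic is
`10234/3 + (-12212)θ + (4859/3)θ²` and `ℚ(β) = ℚ(θ)`. This discharges the (I1M′) input of this row (GEN 9 `hAnaMI_negDisc_of_cubicFieldMu`) in the kernel;
it is statement (A), NOT BSD: BSD₂ for `266256cs1` is NOT proved by this. [cite: CoatesSujatha2005, Conj. A and Thm. 3.4]
[cite: Iwasawa1973MuInvariants, Thm. 2 and Thm. 3] [cite: Fukuda1994, Thm. 1 (1), p. 264] [cite: Lang1990, Ch. 13 §4, Lemma 4.1] -/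
theorem conjA_two_266256cs1' (κ : ZpExtension ℚ 2) (hκ : κ.IsCyclotomic) :
    haveI := isElliptic_266256cs1'
    ∃ (γ : absoluteGaloisGroup ℚ) (D : (⟨0, ((0 : ℤ) : ℚ), 0, ((54621309 : ℤ) : ℚ), ((-97907623038 : ℤ) : ℚ)⟩ : WeierstrassCurve ℚ).FineSelmerDualData κ γ),
      Module.Finite ℤ_[2] (RestrictScalars ℤ_[2] (IwasawaAlgebra 2) D.X) := by
  haveI := isElliptic_266256cs1'
  obtain ⟨θ, hθ⟩ : ∃ θ : AlgebraicClosure ℚ, aeval θ (Cubic.toPoly ⟨1, ((-8 : ℤ) : ℚ), ((5 : ℤ) : ℚ), ((-4 : ℤ) : ℚ)⟩) = 0 :=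
    IsAlgClosed.exists_aeval_eq_zero _ _ (by rw [Cubic.degree_of_a_ne_zero one_ne_zero]; norm_num)
  have hθ' : θ ^ 3 + (-8 : AlgebraicClosure ℚ) * θ ^ 2 + (5 : AlgebraicClosure ℚ) * θ + (-4 : AlgebraicClosure ℚ) = 0 := by
    have := hθ
    simp only [Cubic.toPoly, map_one, one_mul, aeval_add, aeval_mul, aeval_C, aeval_X_pow, aeval_X,
      eq_ratCast, Rat.cast_intCast] at this
    push_cast at this
    linear_combination this
  set β : AlgebraicClosure ℚ := algebraMap ℚ (AlgebraicClosure ℚ) (10234/3 : ℚ) +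
      algebraMap ℚ (AlgebraicClosure ℚ) (-12212 : ℚ) * θ + algebraMap ℚ (AlgebraicClosure ℚ) (4859/3 : ℚ) * θ ^ 2 with hβdef
  have hβ : aeval β (Cubic.toPoly ⟨1, ((0 : ℤ) : ℚ), ((54621309 : ℤ) : ℚ), ((-97907623038 : ℤ) : ℚ)⟩) = 0 := by
    simp only [Cubic.toPoly, map_one, one_mul, aeval_add, aeval_mul, aeval_C, aeval_X_pow, aeval_X, eq_ratCast,
      Rat.cast_intCast]
    rw [hβdef]
    simp only [eq_ratCast]
    push_cast
    linear_combination (((-864824989408 : AlgebraicClosure ℚ) / 27) + ((6299254776031 : AlgebraicClosure ℚ) / 27) * θ + ((-1677151506716 : AlgebraicClosure ℚ) / 27) * θ ^ 2 + ((114720411779 : AlgebraicClosure ℚ) / 27) * θ ^ 3) * hθ'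
  have hadj : IntermediateField.adjoin ℚ {β} = IntermediateField.adjoin ℚ {θ} := by
    apply le_antisymm
    · rw [IntermediateField.adjoin_simple_le_iff, hβdef]
      have hθmem := IntermediateField.mem_adjoin_simple_self ℚ θ
      exact add_mem (add_mem (algebraMap_mem _ _) (mul_mem (algebraMap_mem _ _) hθmem))
        (mul_mem (algebraMap_mem _ _) (pow_mem hθmem 2))
    · rw [IntermediateField.adjoin_simple_le_iff]
      have hθeq : θ = algebraMap ℚ (AlgebraicClosure ℚ) (14087/2048 : ℚ) +
          algebraMap ℚ (AlgebraicClosure ℚ) (19/176128 : ℚ) * β +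
          algebraMap ℚ (AlgebraicClosure ℚ) (113/976982016 : ℚ) * β ^ 2 := by
        rw [hβdef]; simp only [eq_ratCast]; push_cast
        linear_combination (((319225 : AlgebraicClosure ℚ) / 148608) + ((-1442897 : AlgebraicClosure ℚ) / 4755456) * θ) * hθ'
      rw [hθeq]
      have hβmem := IntermediateField.mem_adjoin_simple_self ℚ β
      exact add_mem (add_mem (algebraMap_mem _ _) (mul_mem (algebraMap_mem _ _) hβmem))
        (mul_mem (algebraMap_mem _ _) (pow_mem hβmem 2))
  have h3 : Module.finrank ℚ (IntermediateField.adjoin ℚ {β}) = 3 := by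
    rw [hadj]; exact finrank_adjoin_eq_three_of_irreducible irreducible_cubic_d516n hθ
  exact TotallyComplexMu.conjA_two_cubicModel_of_classicalMu_of_discr_neg (0) (54621309) (-97907623038)
    (irreducible_cubic_of_finrank_adjoin_eq_three hβ h3) (by simp only [Cubic.discr]; norm_num) hβ
    (by rw [hadj]; exact classicalMu_two_cubicField_d516n hθ) κ hκ

/-! ### Row `355008cc1` (cubic field `d = -516`) -/

/-- The census cubic model of the C4″ row `355008cc1` (`y² = x³ + (-1)x² + (-5221460129)x + (-145224119907039)`, addL2x GEN 13 `nst_census` a-invariants) is an elliptic curve. -/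
theorem isElliptic_355008cc1' : (⟨0, ((-1 : ℤ) : ℚ), 0, ((-5221460129 : ℤ) : ℚ), ((-145224119907039 : ℤ) : ℚ)⟩ : WeierstrassCurve ℚ).IsElliptic :=
  isElliptic_cubicModel _ _ _ (by simp only [Cubic.discr]; norm_num)

/-- **UNCONDITIONAL (A)₂ for the C4″ census curve `355008cc1` — ZERO hypotheses, ZERO named facts** (additive potentially multiplicative at `2`,
irreducible `E[2]`, `Δ < 0`; `2`-torsion cubic field `ℚ(θ)`, `θ³ + (-8)θ² + (5)θ + (-4) = 0`, `d = -4644`, `p q^2, F_q=Q2(sqrt-1)`, `h` odd). Coates–Sujatha's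
statement (A) at `p = 2` for the cubic model `y² = x³ + (-1)x² + (-5221460129)x + (-145224119907039)`: for every cyclotomic `ℤ₂`-extension of `ℚ` the dual fine Selmer group
over `ℚ_∞` is finitely generated over `ℤ₂` (`∃ γ D` currency). KERNEL: `classicalMu_two_cubicField_d516n` above (μ₂(ℚ(θ)_cyc) = 0 for the field of `X³ + (-8)X² + (5)X + (-4)`) ⟹ cruxlead-19573-w2's `ℓ = 2` ascent to the totally complex
`ℚ(E[2]) = ℚ(θ, √d)` and kernel Lim 3.5@2 (`TotallyComplexMu.conjA_two_cubicModel_of_classicalMu_of_discr_neg`); the root `β = x(T)` of the curve's cubic is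
`-40305 + (-1720)θ + (2494)θ²` and `ℚ(β) = ℚ(θ)`. This discharges the (I1M′) input of this row (GEN 9 `hAnaMI_negDisc_of_cubicFieldMu`) in the kernel;
it is statement (A), NOT BSD: BSD₂ for `355008cc1` is NOT proved by this. [cite: CoatesSujatha2005, Conj. A and Thm. 3.4]
[cite: Iwasawa1973MuInvariants, Thm. 2 and Thm. 3] [cite: Fukuda1994, Thm. 1 (1), p. 264] [cite: Lang1990, Ch. 13 §4, Lemma 4.1] -/
theorem conjA_two_355008cc1' (κ : ZpExtension ℚ 2) (hκ : κ.IsCyclotomic) :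
    haveI := isElliptic_355008cc1'
    ∃ (γ : absoluteGaloisGroup ℚ) (D : (⟨0, ((-1 : ℤ) : ℚ), 0, ((-5221460129 : ℤ) : ℚ), ((-145224119907039 : ℤ) : ℚ)⟩ : WeierstrassCurve ℚ).FineSelmerDualData κ γ),
      Module.Finite ℤ_[2] (RestrictScalars ℤ_[2] (IwasawaAlgebra 2) D.X) := by
  haveI := isElliptic_355008cc1'
  obtain ⟨θ, hθ⟩ : ∃ θ : AlgebraicClosure ℚ, aeval θ (Cubic.toPoly ⟨1, ((-8 : ℤ) : ℚ), ((5 : ℤ) : ℚ), ((-4 : ℤ) : ℚ)⟩) = 0 :=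
    IsAlgClosed.exists_aeval_eq_zero _ _ (by rw [Cubic.degree_of_a_ne_zero one_ne_zero]; norm_num)
  have hθ' : θ ^ 3 + (-8 : AlgebraicClosure ℚ) * θ ^ 2 + (5 : AlgebraicClosure ℚ) * θ + (-4 : AlgebraicClosure ℚ) = 0 := by
    have := hθ
    simp only [Cubic.toPoly, map_one, one_mul, aeval_add, aeval_mul, aeval_C, aeval_X_pow, aeval_X,
      eq_ratCast, Rat.cast_intCast] at this
    push_cast at this
    linear_combination this
  set β : AlgebraicClosure ℚ := algebraMap ℚ (AlgebraicClosure ℚ) (-40305 : ℚ) +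
      algebraMap ℚ (AlgebraicClosure ℚ) (-1720 : ℚ) * θ + algebraMap ℚ (AlgebraicClosure ℚ) (2494 : ℚ) * θ ^ 2 with hβdef
  have hβ : aeval β (Cubic.toPoly ⟨1, ((-1 : ℤ) : ℚ), ((-5221460129 : ℤ) : ℚ), ((-145224119907039 : ℤ) : ℚ)⟩) = 0 := by
    simp only [Cubic.toPoly, map_one, one_mul, aeval_add, aeval_mul, aeval_C, aeval_X_pow, aeval_X, eq_ratCast,
      Rat.cast_intCast]
    rw [hβdef]
    simp only [eq_ratCast]
    push_cast
    linear_combination ((62496318336 : AlgebraicClosure ℚ) + (-71476793000 : AlgebraicClosure ℚ) * θ + (92006772512 : AlgebraicClosure ℚ) * θ ^ 2 + (15512769784 : AlgebraicClosure ℚ) * θ ^ 3) * hθ'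
  have hadj : IntermediateField.adjoin ℚ {β} = IntermediateField.adjoin ℚ {θ} := by
    apply le_antisymm
    · rw [IntermediateField.adjoin_simple_le_iff, hβdef]
      have hθmem := IntermediateField.mem_adjoin_simple_self ℚ θ
      exact add_mem (add_mem (algebraMap_mem _ _) (mul_mem (algebraMap_mem _ _) hθmem))
        (mul_mem (algebraMap_mem _ _) (pow_mem hθmem 2))
    · rw [IntermediateField.adjoin_simple_le_iff]
      have hθeq : θ = algebraMap ℚ (AlgebraicClosure ℚ) (-32959144631/258800832 : ℚ) +
          algebraMap ℚ (AlgebraicClosure ℚ) (-145733/97050312 : ℚ) * β +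
          algebraMap ℚ (AlgebraicClosure ℚ) (29/776402496 : ℚ) * β ^ 2 := by
        rw [hβdef]; simp only [eq_ratCast]; push_cast
        linear_combination (((-3364 : AlgebraicClosure ℚ) / 2187) + ((-24389 : AlgebraicClosure ℚ) / 104976) * θ) * hθ'
      rw [hθeq]
      have hβmem := IntermediateField.mem_adjoin_simple_self ℚ β
      exact add_mem (add_mem (algebraMap_mem _ _) (mul_mem (algebraMap_mem _ _) hβmem))
        (mul_mem (algebraMap_mem _ _) (pow_mem hβmem 2))
  have h3 : Module.finrank ℚ (IntermediateField.adjoin ℚ {β}) = 3 := by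
    rw [hadj]; exact finrank_adjoin_eq_three_of_irreducible irreducible_cubic_d516n hθ
  exact TotallyComplexMu.conjA_two_cubicModel_of_classicalMu_of_discr_neg (-1) (-5221460129) (-145224119907039)
    (irreducible_cubic_of_finrank_adjoin_eq_three hβ h3) (by simp only [Cubic.discr]; norm_num) hβ
    (by rw [hadj]; exact classicalMu_two_cubicField_d516n hθ) κ hκ
end Summit.BirchSwinnertonDyer.BirchSwinnertonDyer.Theorems.AddKatoTwo

end
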